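import Summits.AtomisticToContinuum.HydrodynamicLimit.Theorems.OneFlightGossipEngineAssemblyEntropyProduction
import Summits.AtomisticToContinuum.HydrodynamicLimit.Theorems.NearConstantShortTimeHL.Negative.LawDichotomy
import Summits.AtomisticToContinuum.HydrodynamicLimit.Theorems.JaynesSqueezeBlockGibbsToRelEntropyEntropyConservation
import Summits.AtomisticToContinuum.HydrodynamicLimit.Theorems.ImplosionDichotomyPolynomialCompressionSolutionAPI
import HarnessLib

/-!
# Crux `NearConstantShortTimeHL` (stmt-AtomisticToContinuum-12502), line `means-pin-entropy` — the entropy bookkeeping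

Support file (`--supports stmt-AtomisticToContinuum-12502`) for the registered stub `stub_meansPin :
GeneralFamilyLDA → GeneralFamilyConcentration → OneMeanLowerBound → NearConstantRelEntropy` (file
`…NearConstantShortTimeHLMeansPin.lean`). This file is the DYNAMICAL half of Yau's bookkeeping at the Euler-matched
reference, for general `(ε_N, n_N)` families of canonical hard-sphere laws on `𝕋³`:

* `klDiv_lawAt_ne_top_and_le` — for a hard-sphere flow `Φ`, an initial probability law `f dZ` and a finite reference
  `g dZ` of mass `≤ 1` (a.e. positive finite densities, `log f = A`, `log g = B` a.e. with `A`, `B ∘ Φ_t`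
  integrable): `KL((Φ_t)_* (f dZ) ‖ g dZ)` is FINITE and `≤ ∫ A f dZ − ∫ (B ∘ Φ_t) f dZ` (the entropy production
  identity `toReal_klDiv_lawAt_sub` with `g₀ = f`, `KL(f dZ ‖ f dZ) = 0`, Liouville invariance);
* `log_canonicalDensity_of_mem`, `canonicalDensity_pos_of_mem` — `log(Z⁻¹ 𝟙_D p^{⊗n}) = n⟨emp, log p⟩ − log Z` on
  the hard-sphere domain;
* `tendsto_zero_of_bookkeeping` — the real-sequence lemma behind "`0 ≤ KL/n ≤ κ + o(1)` for every `κ`";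
* the registered sub-goal `tendsto_klDiv_div_of_means` — **`KL((Φ_N t)_* P_N ‖ Q_N)/n_N → 0`** for the canonical
  laws `P_N`, `Q_N` of two positive profiles `p`, `q` on the same hard-sphere domains, from: `n_N → ∞`, the two
  pressures `n_N⁻¹ log Z_N → π₀, π_t`, the static mean of `log p` under `P_N` (`→ m₀`, eventually integrable), the
  one-sided lower bound `E_{P_N}[mean of log q ∘ Φ_N t] ≥ m_t − κ` eventually for every `κ > 0` (the ENGINE SLOT S3 of
  the line), and the identity `m₀ − π₀ = m_t − π_t` (mass conservation + isentropy, supplied by the pin);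
* `integral_entropy_eq_of_band_Icc` — isentropy of classical hard-sphere-Euler solutions up to a time `t` on whose
  past `[0, t]` the packing guard `ρσ³ < η` holds (`JaynesSqueezeClosure.integral_entropy_eq` on a restricted solution,
  the open band persisting slightly beyond `t` by the tube lemma over the compact torus).

No definitions. References: H.-T. Yau, Lett. Math. Phys. 22 (1991) §2; S. Olla – S.R.S. Varadhan – H.-T. Yau, Comm.
Math. Phys. 155 (1993) §3.
-/

noncomputable section

namespace Summit.AtomisticToContinuum.HydrodynamicLimit.Theorems.NearConstantShortTimeHL

open MeasureTheory InformationTheory Set Filter Topology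
open scoped ENNReal
open Literature.MathematicalPhysics.KineticTheory Literature.Analysis.FluidPDE Literature.Analysis.FunctionSpaces

/-! ## The relative entropy of the evolved law against a reference: finiteness and upper bound -/

section Flow

variable {d : Type*} [Fintype d] {X : Type*} [MeasureSpace X] [TopologicalSpace X] {N : ℕ}
  {G : Geometry d X} {ε : ℝ}

/-- **Yau's bound for the evolved law against a reference density** (real form, one time). For a
hard-sphere flow `Φ`, an initial PROBABILITY law `f dZ` and a finite reference `g dZ` of mass `≤ 1`,
with `f, g` measurable, a.e. positive and everywhere finite, and a.e. identities `log f = A`,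
`log g = B` with `A` and `B ∘ Φ_t` integrable under `f dZ`: the relative entropy
`KL((Φ_t)_* (f dZ) ‖ g dZ)` is finite and at most `∫ A f dZ − ∫ (B ∘ Φ_t) f dZ`
(`toReal_klDiv_lawAt_sub` with `g₀ = f`, `KL(f dZ ‖ f dZ) = 0`). [cite: Yau1991, §2] -/
theorem klDiv_lawAt_ne_top_and_le (Φ : HardSphereFlow G ε N) [SigmaFinite (liouville G N ε)]
    {f g : Config N d X → ℝ≥0∞} (hf : Measurable f) (hg : Measurable g)
    [IsProbabilityMeasure ((liouville G N ε).withDensity f)]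
    [IsFiniteMeasure ((liouville G N ε).withDensity g)]
    (hf0 : ∀ᵐ z ∂liouville G N ε, f z ≠ 0) (hftop : ∀ z, f z ≠ ∞)
    (hg0 : ∀ᵐ z ∂liouville G N ε, g z ≠ 0) (hgtop : ∀ z, g z ≠ ∞)
    (hg1 : (liouville G N ε).withDensity g univ ≤ 1) (t : ℝ)
    {A B : Config N d X → ℝ} (hA : ∀ᵐ z ∂liouville G N ε, Real.log (f z).toReal = A z)
    (hB : ∀ᵐ z ∂liouville G N ε, Real.log (g z).toReal = B z)
    (hAi : Integrable A ((liouville G N ε).withDensity f))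
    (hBi : Integrable (fun z => B (Φ.flow t z)) ((liouville G N ε).withDensity f)) :
    klDiv (Φ.lawAt ((liouville G N ε).withDensity f) t) ((liouville G N ε).withDensity g) ≠ ∞ ∧
    (klDiv (Φ.lawAt ((liouville G N ε).withDensity f) t) ((liouville G N ε).withDensity g)).toReal ≤
      (∫ z, A z ∂((liouville G N ε).withDensity f)) - ∫ z, B (Φ.flow t z) ∂((liouville G N ε).withDensity f) := by
  set L := liouville G N ε with hL
  set P := L.withDensity f with hP
  have hPL : P ≪ L := withDensity_absolutelyContinuous _ _
  have hq := (Φ.measurePreserving t).quasiMeasurePreserving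
  have hgt : Measurable fun z => g (Φ.flow t z) := hg.comp (Φ.measurable_flow t)
  have hgt0 : ∀ᵐ z ∂L, g (Φ.flow t z) ≠ 0 := hq.ae hg0
  have hBt : ∀ᵐ z ∂L, Real.log (g (Φ.flow t z)).toReal = B (Φ.flow t z) := hq.ae hB
  -- the two log-ratios under `P`
  have hint₀ : Integrable (fun z => Real.log (f z).toReal - Real.log (f z).toReal) P := by
    simp only [sub_self]
    exact integrable_zero _ _ _
  have hdiff : (fun z => Real.log (f z).toReal - Real.log (g (Φ.flow t z)).toReal) =ᵐ[P]
      fun z => A z - B (Φ.flow t z) := by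
    filter_upwards [hPL.ae_le hA, hPL.ae_le hBt] with z hzA hzB
    rw [hzA, hzB]
  have hint : Integrable (fun z => Real.log (f z).toReal - Real.log (g (Φ.flow t z)).toReal) P :=
    (hAi.sub hBi).congr hdiff.symm
  refine ⟨?_, ?_⟩
  · -- finiteness: transport to the pulled-back reference, absolute continuity + integrable `llr`
    rw [klDiv_lawAt_withDensity_eq Φ hg t]
    have hac : P ≪ L.withDensity fun z => g (Φ.flow t z) :=
      hPL.trans (withDensity_absolutelyContinuous' hgt.aemeasurable hgt0)
    refine klDiv_ne_top hac ?_
    have hllr := llr_withDensity_ae_eq L hf hgt (Eventually.of_forall fun z => hftop z) hgt0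
      (Eventually.of_forall fun z => hgtop _)
    exact hint.congr hllr.symm
  · have key := toReal_klDiv_lawAt_sub Φ hf hf hg hf0 (Eventually.of_forall fun z => hftop z) hg0
      (Eventually.of_forall fun z => hgtop z) t hint₀ hint
    have hPu : ((liouville G N ε).withDensity f).real univ = 1 := probReal_univ
    rw [klDiv_self, ENNReal.toReal_zero, sub_zero, hPu] at key
    rw [key, integral_congr_ae hdiff, integral_sub hAi hBi]
    have h1 : (L.withDensity g).real univ ≤ 1 := by
      rw [measureReal_def]
      exact ENNReal.toReal_le_of_le_ofReal zero_le_one (by simpa using hg1)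
    linarith

end Flow

/-! ## The log of a canonical density on the hard-sphere domain -/

/-- **Log of a canonical density on the hard-sphere domain**: for a positive profile `p`, a positive
partition function and `n ≠ 0` particles, `log (Z⁻¹ 𝟙_D(z) ∏ᵢ p(zᵢ)) = n ⟨emp z, log p⟩ − log Z` at
every `z ∈ D`. [folklore] -/
theorem log_canonicalDensity_of_mem {n : ℕ} (hn : n ≠ 0) {ε : ℝ} {p : T3 × V3 → ℝ}
    (hp : ∀ y, 0 < p y) (hZ : 0 < canonicalPartition (Torus.geometry (Fin 3)) ε n p)
    {z : Config n (Fin 3) T3} (hz : z ∈ hardSphereDomain (Torus.geometry (Fin 3)) n ε) :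
    Real.log (canonicalDensity (Torus.geometry (Fin 3)) ε n p z) =
      (n : ℝ) * (∫ y, Real.log (p y) ∂(empiricalMeasure z)) -
        Real.log (canonicalPartition (Torus.geometry (Fin 3)) ε n p) := by
  have hpz : ∀ k, p (z k) ≠ 0 := fun k => (hp _).ne'
  rw [canonicalDensity, Set.indicator_of_mem hz, tensorPow,
    Real.log_mul (inv_ne_zero hZ.ne') (Finset.prod_ne_zero_iff.2 fun k _ => hpz k), Real.log_inv,
    Real.log_prod fun k _ => hpz k, integral_empiricalMeasure, ← mul_assoc,
    mul_inv_cancel₀ (by exact_mod_cast hn), one_mul]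
  ring

/-- The canonical density of a positive profile with positive partition function is positive on the
hard-sphere domain. [folklore] -/
theorem canonicalDensity_pos_of_mem {n : ℕ} {ε : ℝ} {p : T3 × V3 → ℝ}
    (hp : ∀ y, 0 < p y) (hZ : 0 < canonicalPartition (Torus.geometry (Fin 3)) ε n p)
    {z : Config n (Fin 3) T3} (hz : z ∈ hardSphereDomain (Torus.geometry (Fin 3)) n ε) :
    0 < canonicalDensity (Torus.geometry (Fin 3)) ε n p z := by
  rw [canonicalDensity, Set.indicator_of_mem hz, tensorPow]
  exact mul_pos (inv_pos.2 hZ) (Finset.prod_pos fun k _ => hp _)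

/-! ## The real bookkeeping -/

/-- **The bookkeeping limit.** If `x_N → m₀`, `p_N → π₀`, `q_N → π_t`, `y_N ≥ m_t − κ` eventually for
every `κ > 0`, `0 ≤ k_N ≤ x_N − p_N − y_N + q_N` eventually, and `m₀ − π₀ = m_t − π_t`, then `k_N → 0`.
[folklore] -/
theorem tendsto_zero_of_bookkeeping {k x p q y : ℕ → ℝ} {m₀ π₀ mt πt : ℝ}
    (hx : Tendsto x atTop (𝓝 m₀)) (hp : Tendsto p atTop (𝓝 π₀)) (hq : Tendsto q atTop (𝓝 πt))
    (hy : ∀ κ : ℝ, 0 < κ → ∀ᶠ N in atTop, mt - κ ≤ y N)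
    (hk0 : ∀ᶠ N in atTop, 0 ≤ k N) (hk : ∀ᶠ N in atTop, k N ≤ x N - p N - y N + q N)
    (hid : m₀ - π₀ = mt - πt) : Tendsto k atTop (𝓝 0) := by
  have hs : Tendsto (fun N => x N - p N + q N) atTop (𝓝 (m₀ - π₀ + πt)) := (hx.sub hp).add hq
  have hlim : m₀ - π₀ + πt = mt := by linarith
  rw [hlim] at hs
  refine tendsto_order.2 ⟨fun a ha => ?_, fun b hb => ?_⟩
  · filter_upwards [hk0] with N hN
    exact ha.trans_le hN
  · have h1 : ∀ᶠ N in atTop, x N - p N + q N < mt + b / 2 := hs (Iio_mem_nhds (by linarith))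
    filter_upwards [h1, hy (b / 2) (by linarith), hk] with N hN1 hN2 hN3
    linarith

/-! ## Relative entropy `o(n_N)` from the static inputs and the one-mean lower bound (registered sub-goal) -/

/-- **Yau's bookkeeping, general `(ε_N, n_N)` families.** Let `p, q` be positive measurable
one-particle profiles on `𝕋³ × ℝ³`, `P_N = Z_N(p)⁻¹ 𝟙_D p^{⊗n_N} dZ` the canonical hard-sphere laws of
`p` — assumed to be probability measures — and `Q_N` those of `q`, whose partition functions are positive
as soon as those of `p` are nonzero (same hard-sphere domain). Suppose `n_N → ∞`,
`n_N⁻¹ log Z_N(p) → π₀`, `n_N⁻¹ log Z_N(q) → π_t`, the empirical mean of `Λ_A = log p` is eventually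
`P_N`-integrable with expectation `→ m₀`, and for every `κ > 0` eventually the empirical mean of
`Λ_B = log q` at time `t` is `P_N`-integrable with expectation `≥ m_t − κ`. If `m₀ − π₀ = m_t − π_t`, then
`KL((Φ_N t)_* P_N ‖ Q_N)/n_N → 0`: by the entropy production identity along the flow
(`KL(P‖P) = 0`, Liouville invariance) `0 ≤ KL/n_N ≤ [E(Λ_A) − n⁻¹log Z(p)] − [E(Λ_B ∘ Φ_t) − n⁻¹ log Z(q)]`,
whose limsup is `≤ κ` for every `κ`. [cite: Yau1991, §2] -/
theorem tendsto_klDiv_div_of_means :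
    ∀ {ε : ℕ → ℝ} {n : ℕ → ℕ} (Φ : (N : ℕ) → HardSphereFlow (Torus.geometry (Fin 3)) (ε N) (n N)),
    Tendsto n atTop atTop → ∀ {p q : T3 × V3 → ℝ}, Measurable p → Measurable q → (∀ y, 0 < p y) → (∀ y, 0 < q y) →
    (∀ N, canonicalPartition (Torus.geometry (Fin 3)) (ε N) (n N) p ≠ 0 →
      0 < canonicalPartition (Torus.geometry (Fin 3)) (ε N) (n N) q) →
    ∀ P : (N : ℕ) → Measure (Config (n N) (Fin 3) T3),
    (∀ N, P N = particleLaw (Φ N) (canonicalDensity (Torus.geometry (Fin 3)) (ε N) (n N) p)) →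
    (∀ N, IsProbabilityMeasure (P N)) →
    ∀ {ΛA ΛB : T3 × V3 → ℝ}, (∀ y, Real.log (p y) = ΛA y) → (∀ y, Real.log (q y) = ΛB y) →
    ∀ (t : ℝ) {m₀ π₀ mt πt : ℝ},
    Tendsto (fun N => (n N : ℝ)⁻¹ *
      Real.log (canonicalPartition (Torus.geometry (Fin 3)) (ε N) (n N) p)) atTop (𝓝 π₀) →
    Tendsto (fun N => (n N : ℝ)⁻¹ *
      Real.log (canonicalPartition (Torus.geometry (Fin 3)) (ε N) (n N) q)) atTop (𝓝 πt) →
    (∀ᶠ N in atTop, Integrable (fun z => ∫ y, ΛA y ∂(empiricalMeasure z))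
      (particleLaw (Φ N) (canonicalDensity (Torus.geometry (Fin 3)) (ε N) (n N) p))) →
    Tendsto (fun N => ∫ z, (∫ y, ΛA y ∂(empiricalMeasure z))
      ∂(particleLaw (Φ N) (canonicalDensity (Torus.geometry (Fin 3)) (ε N) (n N) p))) atTop (𝓝 m₀) →
    (∀ κ : ℝ, 0 < κ → ∀ᶠ N in atTop,
      Integrable (fun z => ∫ y, ΛB y ∂(empiricalMeasure ((Φ N).flow t z))) (P N) ∧
      mt - κ ≤ ∫ z, (∫ y, ΛB y ∂(empiricalMeasure ((Φ N).flow t z))) ∂(P N)) →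
    m₀ - π₀ = mt - πt →
    Tendsto (fun N => klDiv ((Φ N).lawAt (P N) t)
      (particleLaw (Φ N) (canonicalDensity (Torus.geometry (Fin 3)) (ε N) (n N) q)) / (n N : ℝ≥0∞))
      atTop (𝓝 0) := by
  intro ε n Φ hn p q hpm hqm hp0 hq0 hZ P hPp hP ΛA ΛB hΛA hΛB t m₀ π₀ mt πt hπ₀ hπt hm₀i hm₀ hmt hid
  obtain rfl : P = fun N => particleLaw (Φ N) (canonicalDensity (Torus.geometry (Fin 3)) (ε N) (n N) p) :=
    funext hPp
  -- notation
  set Zp : ℕ → ℝ := fun N => canonicalPartition (Torus.geometry (Fin 3)) (ε N) (n N) p with hZp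
  set Zq : ℕ → ℝ := fun N => canonicalPartition (Torus.geometry (Fin 3)) (ε N) (n N) q with hZq
  set P : (N : ℕ) → Measure (Config (n N) (Fin 3) T3) := fun N =>
    particleLaw (Φ N) (canonicalDensity (Torus.geometry (Fin 3)) (ε N) (n N) p) with hPdef
  set Q : (N : ℕ) → Measure (Config (n N) (Fin 3) T3) := fun N =>
    particleLaw (Φ N) (canonicalDensity (Torus.geometry (Fin 3)) (ε N) (n N) q) with hQdef
  set mA : (N : ℕ) → Config (n N) (Fin 3) T3 → ℝ := fun N z => ∫ y, ΛA y ∂(empiricalMeasure z) with hmA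
  set mB : (N : ℕ) → Config (n N) (Fin 3) T3 → ℝ := fun N z => ∫ y, ΛB y ∂(empiricalMeasure z) with hmB
  set K : ℕ → ℝ≥0∞ := fun N => klDiv ((Φ N).lawAt (P N) t) (Q N) with hK
  -- the partition functions are positive
  have hZp0 : ∀ N, 0 < Zp N := by
    intro N
    refine lt_of_le_of_ne (canonicalPartition_nonneg _ _ _ fun y => (hp0 y).le) (Ne.symm fun h0 => ?_)
    have hzero : P N = 0 := by
      simp only [hPdef, particleLaw_eq]
      have : (fun z => ENNReal.ofReal (canonicalDensity (Torus.geometry (Fin 3)) (ε N) (n N) p z)) = 0 := by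
        funext z
        simp only [canonicalDensity, Pi.zero_apply]
        rw [show canonicalPartition (Torus.geometry (Fin 3)) (ε N) (n N) p = 0 from h0, inv_zero, zero_mul,
          ENNReal.ofReal_zero]
      rw [this, withDensity_zero]
    have h1 := (hP N).measure_univ
    rw [hzero] at h1
    simp at h1
  have hZq0 : ∀ N, 0 < Zq N := fun N => hZ N (hZp0 N).ne'
  -- the reference laws are finite with mass at most one
  have hQ : ∀ N, IsFiniteMeasure (Q N) ∧ Q N univ ≤ 1 := by
    intro N
    rcases NearConstantShortTimeHLNegative.particleLaw_canonicalDensity_zero_or_prob (Φ N)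
      (f₀ := q) (fun y => (hq0 y).le) with h | h
    · have hQ0 : Q N = 0 := h
      refine ⟨?_, ?_⟩
      · rw [hQ0]; infer_instance
      · rw [hQ0]; simp
    · exact ⟨inferInstance, prob_le_one⟩
  -- eventually: `n_N ≥ 1`, the two integrabilities
  have hn1 : ∀ᶠ N in atTop, 1 ≤ n N := hn.eventually_ge_atTop 1
  obtain hBint := hmt 1 one_pos
  -- the per-`N` estimate
  have hest : ∀ᶠ N in atTop, K N ≠ ⊤ ∧ (K N).toReal ≤
      (n N : ℝ) * (∫ z, mA N z ∂(P N)) - Real.log (Zp N) -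
        (n N : ℝ) * (∫ z, mB N ((Φ N).flow t z) ∂(P N)) + Real.log (Zq N) := by
    filter_upwards [hn1, hm₀i, hBint] with N hN1 hAint hBint'
    obtain ⟨hBint1, -⟩ := hBint'
    have hn0 : n N ≠ 0 := by omega
    haveI hXE : SigmaFinite (volume : Measure (T3 × V3)) := inferInstance
    haveI hC : SigmaFinite (volume : Measure (Config (n N) (Fin 3) T3)) := inferInstance
    haveI hL : SigmaFinite (liouville (Torus.geometry (Fin 3)) (n N) (ε N)) := by
      rw [liouville_eq]; infer_instance
    set f : Config (n N) (Fin 3) T3 → ℝ≥0∞ := fun z =>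
      ENNReal.ofReal (canonicalDensity (Torus.geometry (Fin 3)) (ε N) (n N) p z) with hf
    set g : Config (n N) (Fin 3) T3 → ℝ≥0∞ := fun z =>
      ENNReal.ofReal (canonicalDensity (Torus.geometry (Fin 3)) (ε N) (n N) q z) with hg
    have hPf : P N = (liouville (Torus.geometry (Fin 3)) (n N) (ε N)).withDensity f := rfl
    have hQg : Q N = (liouville (Torus.geometry (Fin 3)) (n N) (ε N)).withDensity g := rfl
    have hfm : Measurable f := (measurable_canonicalDensity (ε N) (n N) hpm).ennreal_ofReal
    have hgm : Measurable g := (measurable_canonicalDensity (ε N) (n N) hqm).ennreal_ofReal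
    haveI : IsProbabilityMeasure ((liouville (Torus.geometry (Fin 3)) (n N) (ε N)).withDensity f) := hP N
    haveI : IsFiniteMeasure ((liouville (Torus.geometry (Fin 3)) (n N) (ε N)).withDensity g) := (hQ N).1
    have hD := ae_restrict_mem (μ := (volume : Measure (Config (n N) (Fin 3) T3)))
      (measurableSet_hardSphereDomain (Torus.geometry (Fin 3)) Torus.measurable_geometry_sepVec (n N) (ε N))
    rw [← liouville_eq] at hD
    have hf0 : ∀ᵐ z ∂liouville (Torus.geometry (Fin 3)) (n N) (ε N), f z ≠ 0 := by
      filter_upwards [hD] with z hz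
      exact (ENNReal.ofReal_pos.2 (canonicalDensity_pos_of_mem hp0 (hZp0 N) hz)).ne'
    have hg0 : ∀ᵐ z ∂liouville (Torus.geometry (Fin 3)) (n N) (ε N), g z ≠ 0 := by
      filter_upwards [hD] with z hz
      exact (ENNReal.ofReal_pos.2 (canonicalDensity_pos_of_mem hq0 (hZq0 N) hz)).ne'
    set A : Config (n N) (Fin 3) T3 → ℝ := fun z => (n N : ℝ) * mA N z - Real.log (Zp N) with hA
    set B : Config (n N) (Fin 3) T3 → ℝ := fun z => (n N : ℝ) * mB N z - Real.log (Zq N) with hB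
    have hlogA : ∀ᵐ z ∂liouville (Torus.geometry (Fin 3)) (n N) (ε N), Real.log (f z).toReal = A z := by
      filter_upwards [hD] with z hz
      rw [hf, hA, hmA]
      dsimp only
      rw [ENNReal.toReal_ofReal (canonicalDensity_pos_of_mem hp0 (hZp0 N) hz).le,
        log_canonicalDensity_of_mem hn0 hp0 (hZp0 N) hz]
      simp_rw [hΛA]
      rfl
    have hlogB : ∀ᵐ z ∂liouville (Torus.geometry (Fin 3)) (n N) (ε N), Real.log (g z).toReal = B z := by
      filter_upwards [hD] with z hz
      rw [hg, hB, hmB]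
      dsimp only
      rw [ENNReal.toReal_ofReal (canonicalDensity_pos_of_mem hq0 (hZq0 N) hz).le,
        log_canonicalDensity_of_mem hn0 hq0 (hZq0 N) hz]
      simp_rw [hΛB]
      rfl
    have hAi : Integrable A ((liouville (Torus.geometry (Fin 3)) (n N) (ε N)).withDensity f) := by
      rw [← hPf]
      exact (hAint.const_mul _).sub (integrable_const _)
    have hBi : Integrable (fun z => B ((Φ N).flow t z))
        ((liouville (Torus.geometry (Fin 3)) (n N) (ε N)).withDensity f) := by
      rw [← hPf]
      exact (hBint1.const_mul _).sub (integrable_const _)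
    obtain ⟨htop, hle⟩ := klDiv_lawAt_ne_top_and_le (Φ N) hfm hgm hf0 (fun z => ENNReal.ofReal_ne_top) hg0
      (fun z => ENNReal.ofReal_ne_top) (by rw [← hQg]; exact (hQ N).2) t hlogA hlogB hAi hBi
    rw [← hPf, ← hQg] at htop hle
    refine ⟨htop, hle.trans (le_of_eq ?_)⟩
    rw [hA, hB]
    dsimp only
    rw [integral_sub (hAint.const_mul _) (integrable_const _),
      integral_sub (hBint1.const_mul _) (integrable_const _), integral_const_mul, integral_const_mul,
      integral_const, integral_const, probReal_univ, one_smul, one_smul]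
    ring
  -- the bookkeeping in real numbers
  have hreal : Tendsto (fun N => (K N / (n N : ℝ≥0∞)).toReal) atTop (𝓝 0) := by
    refine tendsto_zero_of_bookkeeping (x := fun N => ∫ z, mA N z ∂(P N))
      (p := fun N => (n N : ℝ)⁻¹ * Real.log (Zp N)) (q := fun N => (n N : ℝ)⁻¹ * Real.log (Zq N))
      (y := fun N => ∫ z, mB N ((Φ N).flow t z) ∂(P N)) hm₀ hπ₀ hπt
      (fun κ hκ => (hmt κ hκ).mono fun N hN => hN.2) (Eventually.of_forall fun N => ENNReal.toReal_nonneg) ?_ hid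
    filter_upwards [hest, hn1] with N hN hN1
    have hnpos : (0 : ℝ) < n N := by exact_mod_cast hN1
    rw [ENNReal.toReal_div, ENNReal.toReal_natCast, div_le_iff₀ hnpos]
    have := hN.2
    have e : ((∫ z, mA N z ∂(P N)) - (n N : ℝ)⁻¹ * Real.log (Zp N) - (∫ z, mB N ((Φ N).flow t z) ∂(P N)) +
        (n N : ℝ)⁻¹ * Real.log (Zq N)) * (n N : ℝ) =
        (n N : ℝ) * (∫ z, mA N z ∂(P N)) - Real.log (Zp N) -
          (n N : ℝ) * (∫ z, mB N ((Φ N).flow t z) ∂(P N)) + Real.log (Zq N) := by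
      field_simp
    rw [e]
    exact this
  -- back to `ℝ≥0∞`
  have hfin : ∀ᶠ N in atTop, K N / (n N : ℝ≥0∞) ≠ ⊤ := by
    filter_upwards [hest, hn1] with N hN hN1
    exact ENNReal.div_ne_top hN.1 (by exact_mod_cast (show n N ≠ 0 by omega))
  have h := ENNReal.tendsto_ofReal hreal
  rw [ENNReal.ofReal_zero] at h
  refine h.congr' ?_
  filter_upwards [hfin] with N hN
  exact ENNReal.ofReal_toReal hN

/-! ## Isentropy up to a guarded time -/

/-- **Conservation of the thermodynamic entropy up to a guarded time.** If `f_ex` is smooth on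
`(0, η)`, `(ρ, u, θ)` is a classical hard-sphere-Euler solution on `[0, T)`, `t ∈ [0, T)` and the band
`ρ σ³ < η` holds on `[0, t] × 𝕋³`, then `∫ ρ_t s_σ(ρ_t, θ_t) = ∫ ρ₀ s_σ(ρ₀, θ₀)`: by the tube lemma over
the compact torus the (open) band persists on some `[0, T′)`, `t < T′ ≤ T`, and the restricted solution
(`isHardSphereEulerSolution_restrict`) is isentropic there (`JaynesSqueezeClosure.integral_entropy_eq`).
[folklore] -/
theorem integral_entropy_eq_of_band_Icc {σ η T : ℝ} {ρ θ : ℝ → T3 → ℝ} {u : ℝ → T3 → V3} (hσ : 0 < σ)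
    (hf : ContDiffOn ℝ ((⊤ : ℕ∞) : WithTop ℕ∞) hsExcessFreeEnergy (Ioo 0 η)) (hE : IsHardSphereEulerSolution σ T ρ u θ)
    {t : ℝ} (ht : t ∈ Ico 0 T) (hband : ∀ s ∈ Icc 0 t, ∀ x, ρ s x * σ ^ 3 < η) :
    ∫ x, ρ t x * (3 / 2 * Real.log (θ t x) - Real.log (ρ t x) - hsExcessFreeEnergy (ρ t x * σ ^ 3)) =
      ∫ x, ρ 0 x * (3 / 2 * Real.log (θ 0 x) - Real.log (ρ 0 x) - hsExcessFreeEnergy (ρ 0 x * σ ^ 3)) := by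
  have hσ3 : 0 < σ ^ 3 := pow_pos hσ 3
  -- a uniform margin at time `t`
  have hcont : Continuous fun x => ρ t x * σ ^ 3 :=
    (hE.smooth_density.isSmooth_slice ht).continuous.mul continuous_const
  obtain ⟨x₀, -, hx₀⟩ := isCompact_univ.exists_isMaxOn univ_nonempty hcont.continuousOn
  set m : ℝ := ρ t x₀ * σ ^ 3 with hm
  have hmη : m < η := hband t (right_mem_Icc.2 ht.1) x₀
  set δ : ℝ := (η - m) / (2 * σ ^ 3) with hδ
  have hδ0 : 0 < δ := div_pos (sub_pos.2 hmη) (by positivity)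
  -- the tube lemma: near `t` (within `[0, T)`) the band persists
  have hev : ∀ᶠ s in 𝓝[Ico 0 T] t, ∀ x, ρ s x * σ ^ 3 < η := by
    filter_upwards [hE.smooth_density.eventually_norm_sub_lt ht hδ0] with s hs x
    have h1 : ρ s x < ρ t x + δ := by
      have := hs x
      rw [Real.norm_eq_abs, abs_lt] at this
      linarith [this.2]
    have h2 : ρ t x * σ ^ 3 ≤ m := hx₀ (mem_univ x)
    calc ρ s x * σ ^ 3 < (ρ t x + δ) * σ ^ 3 := mul_lt_mul_of_pos_right h1 hσ3
      _ = ρ t x * σ ^ 3 + (η - m) / 2 := by rw [hδ]; field_simp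
      _ < η := by linarith
  rw [eventually_nhdsWithin_iff, Metric.eventually_nhds_iff] at hev
  obtain ⟨r, hr, hrP⟩ := hev
  set T' : ℝ := min T (t + r / 2) with hT'
  have htT' : t < T' := lt_min ht.2 (by linarith)
  have hT'T : T' ≤ T := min_le_left _ _
  have hband' : ∀ s ∈ Ico 0 T', ∀ x, ρ s x * σ ^ 3 < η := by
    intro s hs x
    rcases le_or_gt s t with hst | hst
    · exact hband s ⟨hs.1, hst⟩ x
    · refine hrP ?_ ⟨hs.1, hs.2.trans_le hT'T⟩ x
      rw [Real.dist_eq, abs_lt]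
      constructor <;> linarith [hs.2.trans_le (min_le_right T (t + r / 2))]
  exact JaynesSqueezeClosure.integral_entropy_eq hσ hf (isHardSphereEulerSolution_restrict hE hT'T) hband'
    ⟨ht.1, htT'⟩

end Summit.AtomisticToContinuum.HydrodynamicLimit.Theorems.NearConstantShortTimeHL

end
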